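import Summits.QuantumFields.BalabanUV.T4Continuum.Spine.NE2.OneStepLoopHolonomy
import Summits.QuantumFields.BalabanUV.T4Continuum.Spine.NE2.OneStepRemainderAdjoint
import Summits.QuantumFields.BalabanUV.T4Continuum.Spine.NE2.ComposedRemainderTower
import Literature.MathematicalPhysics.QuantumFieldTheory.Balaban1983to89.BlockAveragingFederbushGValued

/-!
# T⁴ programme, spine node NE2 (U1a) — R14 W3c, file 3: (124)'s COEFFICIENT DATA `G₁, G₂, G₃` AS FUNCTIONS OF THE BACKGROUND — THE `RemCoeff` SUPPLIER — AND THEIR (126)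
# LETTER `‖G_i‖ ≤ 64·d·L²·p` FROM THE PLAQUETTE LETTER `p` OF THE FIELD AVERAGED AT THAT STEP (cell `pub-balaban-gaps`, seat ne2 gen 6)

[B7] p. 36: «The remaining terms are small because the functions `g(−z)`, `g⁻¹(z)`, `e^{iz}` are equal to `1` for `z = 0`, so the operators occurring in these terms can be estimated by
`O(L²α₀)`», with (p. 36) «`|Y_x| = O(L²α₀)`», `Y_x = (1/i) log V₀(Γ_{c,x} ∪ (−c))` (114), `Y = Σ_{x∈B(c₋)} L^{−d} Y_x` (p. 35), under (44)/(109) «`|V₀(∂p) − 1| < α₀`».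
The tree holds the three links separately: `OneStepRemainder` takes the coefficient operators `G₁ = g(−i ad_Y)g⁻¹(−i ad_{Y_x}) − 1`, `G₂`, `G₃` of (124) as DATA with a letter `γ`
(packaged per step as `ComposedRemainderTower.RemCoeff`, consumed by `ComposedRemainderTwoLevel.composed_full_averaging_rate_of_letters` through `hG₁/hG₂/hG₃/hRc`);
`OneStepRemainderAdjoint` gives `‖G_i(Y, Y_x)‖ ≤ 32y` for hermitian `Y, Y_x` of norm `≤ y ≤ 1/8` in the adjoint component basis; `OneStepLoopHolonomy` gives `‖Y_x‖, ‖Y‖ ≤ 2dL²p`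
and hermiticity from the plaquette letter `p` by the Stokes ladder.  THIS FILE composes them:
 * §1 the loop data of a tower of FUNDAMENTAL bond fields `U : (i : ℕ) → Fin d → idx L M i → Matrix n n ℂ` at the coarse bond `(x, μ)` of level `i` (corner `cpt x`, fine field
   `U (i+1)`): **`YxT`**, **`YbarT`**; and **`remCoeffOf c e U W`** `: RemCoeff d L M ι` — `G₁ i x μ r := coeffG₁ c e (Ȳ) (Y_x)`, `G₂`, `G₃` (block weight `L^{−d}`), and
   `Rc i x μ := W i μ (x, μ)` (print's `R̄_{0,c} = R((V̄₀)_c)`: the ADJOINT field of level `i` read at the coarse bond — DATA `W`, in the intended reading `W i = Ad ∘ U i`, the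
   average of `U (i+1)`; [B7] (15)'s average itself is untyped, DIVERGENCE F6 (ζ));
 * §2 **`norm_remCoeffOf_G₁_le`** / `…G₂…` / `…G₃…`: for unitary `U` with plaquette letters `p (i+1)` on the level-`(i+1)` field in commutator form and `d·L²·p (i+1) ≤ 1/16`,
   `‖G_i‖ ≤ 64·d·L²·p (i+1)` — print's «`O(L²α₀)`» with the constant `64d` — given that the `Y_x` lie in the carrier subspace `P` of the adjoint frame (automatic when `P` is all
   hermitian matrices: `YxT_mem_of_hermitian`; and for a LOG-CHARTED structure group `G` — `BlockAveragingFederbushGValued.LogChart`, e.g. `specialUnitaryLogChart` for `SU(N)` — whose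
   Lie algebra maps into `P` under `X ↦ (−i)X`, once the loop is within the chart radius: `YxT_mem_of_logChart`); `norm_remCoeffOf_Rc_le` (`≤ 1` for contractive `W`).
So the `γ k i` letters of `composed_full_averaging_rate_of_letters` are DISCHARGED from (3.35)-shape plaquette letters of the data tower; what stays displayed there are the per-bond
sizes, NE3-type cross-problem letters (`cW`, `δG`, `δR`, `θ`), and the rate inequality `hrate`.
HONEST FRAMING (T4-DAG p. 1).  [folklore] composition of kernel lemmas about MODEL objects; `U`, `W`, the frame `(c, P, e)` are DATA asserted by nobody; nothing of Bałaban's asserted beyond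
the displayed reading of (124)/(114); NOT an instance of Bałaban's minimiser or of (3.35); NOT NE2, NOT [B9] (3.16)/(3.26) as printed; **NE2 (U1a) NOT PROVED**; spine PROVED 0/9
unchanged; NOT continuum YM / infinite volume / mass gap / Clay.  HONEST DEPENDENCY: continuum YM on T⁴ ⇐ BetaPertH ∧ nine spine estimates (0/9 proved); BetaPertH ⇐ (D1) ∧ (D4) ∧
CAP+tail; G-an2-4 gates asym, D1 and NE2/3/4.  No `sorry`.
-/

noncomputable section

open scoped BigOperators ComplexConjugate Matrix Matrix.Norms.L2Operator

namespace Summit.QuantumFields.BalabanUV.T4Continuum.NE2.OneStepRemainderLoopCoeff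

open Literature.MathematicalPhysics.QuantumFieldTheory.Balaban1983to89.B5Prop11Plancherel (Tor fine unitVec)
open Literature.MathematicalPhysics.QuantumFieldTheory.Balaban1983to89.B5G183RateUnitTower (lev lev_neZero)
open Literature.MathematicalPhysics.QuantumFieldTheory.Balaban1983to89.B5G183RateTorus (cpt)
open Literature.MathematicalPhysics.QuantumFieldTheory.Balaban1983to89.B9AdOrthogonal (form)
open Summit.QuantumFields.BalabanUV.T4Continuum.BalabanAveragedTowerUnit (idx)
open Literature.MathematicalPhysics.QuantumFieldTheory.Balaban1983to89 (LogChart)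
open Summit.QuantumFields.BalabanUV.T4Continuum.CovariantBlockAveraging (transport leg)
open Summit.QuantumFields.BalabanUV.T4Continuum.NE2.CovariantTableBalaban (contourFrom)
open Summit.QuantumFields.BalabanUV.T4Continuum.NE2.OneStepLoopHolonomy (Yx Ybar loopHol norm_Yx_le_of_plaquettes norm_Ybar_le_of_plaquettes norm_loopHol_sub_one_le_of_digits)
open Summit.QuantumFields.BalabanUV.T4Continuum.NE2.OneStepRemainderAdjoint (coeffG₁ coeffG₂ coeffG₃ norm_coeffG₁_le norm_coeffG₂_le norm_coeffG₃_le)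
open Summit.QuantumFields.BalabanUV.T4Continuum.NE2.ComposedRemainderTower (RemCoeff)

variable {d : ℕ} (L : ℕ) [NeZero L] (M : Fin d → ℕ) [hM : ∀ μ, NeZero (M μ)] {n : Type} [Fintype n] [DecidableEq n] {ι : Type} [Fintype ι] [DecidableEq ι]

/-! ## §1 The loop data along the tower and the coefficient supplier -/

section Supplier

variable (U : (i : ℕ) → Fin d → (idx L M i → Matrix n n ℂ))

/-- **`Y_x` AT STEP `i`**: the loop logarithm (114) of the level-`(i+1)` field for the coarse bond `(x, μ)` of level `i` and the block point of digits `r` (corner `cpt x = L·x`).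
[cite: Balaban1985Averaging, (114) p.34] [folklore] -/
def YxT (i : ℕ) (x : Tor (fine (lev L i) M)) (μ : Fin d) (r : Fin d → Fin L) : Matrix n n ℂ :=
  Yx (L * lev L i) M (U (i + 1)) μ L (cpt (lev L i) L M x) (fun ν => (r ν : ℕ))

/-- **`Y` AT STEP `i`**: the block mean `Σ_x L^{−d} Y_x` (p. 35) for the coarse bond `(x, μ)` of level `i`. [cite: Balaban1985Averaging, p.35] [folklore] -/
def YbarT (i : ℕ) (x : Tor (fine (lev L i) M)) (μ : Fin d) : Matrix n n ℂ :=
  Ybar (L * lev L i) M (U (i + 1)) μ L (cpt (lev L i) L M x)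

omit hM in
/-- `YbarT` is the `L^{−d}`-weighted mean of the `YxT`. [folklore] -/
theorem YbarT_eq (i : ℕ) (x : Tor (fine (lev L i) M)) (μ : Fin d) :
    YbarT L M U i x μ = ∑ r : Fin d → Fin L, (((L : ℝ) ^ d)⁻¹) • YxT L M U i x μ r := rfl

/-- **THE `RemCoeff` SUPPLIER**: (124)'s coefficient operators as the §A functional calculus of the loop logarithms of the background, in the adjoint frame `(c, e)`:
`G₁ = g(−i ad_Y)g⁻¹(−i ad_{Y_x}) − 1`, `G₂ = g(−i ad_Y)g⁻¹(i ad_{Y_x})e^{−i ad_Y} − 1`, `G₃ = e^{i ad_Y} − g(−i ad_Y)Σ_x L^{−d}g⁻¹(i ad_{Y_x})`, and `R̄_{0,c}` = the level-`i` adjoint field `W i`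
read at the coarse bond. [cite: Balaban1985Averaging, (124) p.36] [folklore] -/
def remCoeffOf (c : ℝ) (e : ι → Matrix n n ℂ) (W : (i : ℕ) → Fin d → (idx L M i → Matrix ι ι ℂ)) : RemCoeff d L M ι where
  G₁ i x μ r := coeffG₁ c e (YbarT L M U i x μ) (YxT L M U i x μ r)
  G₂ i x μ r := coeffG₂ c e (YbarT L M U i x μ) (YxT L M U i x μ r)
  G₃ i x μ := coeffG₃ Finset.univ (fun _ : Fin d → Fin L => ((L : ℝ) ^ d)⁻¹) c e (YbarT L M U i x μ) (fun r => YxT L M U i x μ r)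
  Rc i x μ := W i μ (x, μ)

end Supplier

/-! ## §2 The (126) letters from the plaquette letters -/

section Letters

variable {U : (i : ℕ) → Fin d → (idx L M i → Matrix n n ℂ)}

omit [DecidableEq n] in
/-- the probability weight `L^{−d}` on the block digits. [folklore] -/
theorem sum_blockWeight : ∑ _r : Fin d → Fin L, ((L : ℝ) ^ d)⁻¹ = 1 := by
  have hL : (0 : ℝ) < (L : ℝ) ^ d := pow_pos (by exact_mod_cast Nat.pos_of_ne_zero (NeZero.ne L)) d
  rw [Finset.sum_const, Finset.card_univ, Fintype.card_fun, Fintype.card_fin, Fintype.card_fin, nsmul_eq_mul]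
  push_cast
  exact mul_inv_cancel₀ hL.ne'

omit hM in
/-- **THE LOOP LETTERS ALONG THE TOWER, `Y_x`**: unitary data with plaquette letter `p` on the level-`(i+1)` field and `d·L²·p ≤ 1/4` give `‖Y_x‖ ≤ 2dL²p`, `Y_x` hermitian.
[cite: Balaban1985Averaging, p.36 (|Y_x| = O(L²α₀))] [folklore] -/
theorem Yx_letters [Nonempty n] (hUu : ∀ i ν b, U i ν b ∈ Matrix.unitaryGroup n ℂ) {p : ℝ} (hp0 : 0 ≤ p) (i : ℕ)
    (hp : ∀ (x : Tor (fine (L * lev L i) M)) (ν μ : Fin d),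
      ‖U (i + 1) ν (x, μ) * U (i + 1) μ (x + unitVec (fine (L * lev L i) M) ν, μ) - U (i + 1) μ (x, μ) * U (i + 1) ν (x + unitVec (fine (L * lev L i) M) μ, μ)‖ ≤ p)
    (hsmall : d * (L : ℝ) ^ 2 * p ≤ 1 / 4) (x : Tor (fine (lev L i) M)) (μ : Fin d) (r : Fin d → Fin L) :
    ‖YxT L M U i x μ r‖ ≤ 2 * (d * (L : ℝ) ^ 2 * p) ∧ (YxT L M U i x μ r).IsHermitian :=
  norm_Yx_le_of_plaquettes (L * lev L i) M μ L (V := U (i + 1)) (hUu (i + 1)) hp0 (fun y ν => hp y ν μ) hsmall _ r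

omit hM in
/-- **THE LOOP LETTERS ALONG THE TOWER, `Y`**: the block mean obeys the same letter and is hermitian. [cite: Balaban1985Averaging, p.36 (shape)] [folklore] -/
theorem Ybar_letters [Nonempty n] (hUu : ∀ i ν b, U i ν b ∈ Matrix.unitaryGroup n ℂ) {p : ℝ} (hp0 : 0 ≤ p) (i : ℕ)
    (hp : ∀ (x : Tor (fine (L * lev L i) M)) (ν μ : Fin d),
      ‖U (i + 1) ν (x, μ) * U (i + 1) μ (x + unitVec (fine (L * lev L i) M) ν, μ) - U (i + 1) μ (x, μ) * U (i + 1) ν (x + unitVec (fine (L * lev L i) M) μ, μ)‖ ≤ p)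
    (hsmall : d * (L : ℝ) ^ 2 * p ≤ 1 / 4) (x : Tor (fine (lev L i) M)) (μ : Fin d) :
    ‖YbarT L M U i x μ‖ ≤ 2 * (d * (L : ℝ) ^ 2 * p) ∧ (YbarT L M U i x μ).IsHermitian :=
  norm_Ybar_le_of_plaquettes (L * lev L i) M μ L (V := U (i + 1)) (hUu (i + 1)) hp0 (fun y ν => hp y ν μ) hsmall _

omit hM in
/-- when the frame's carrier subspace is ALL hermitian matrices (structure group `U(N)`), the loop logarithms lie in it automatically. [folklore] -/
theorem YxT_mem_of_hermitian [Nonempty n] (P : Submodule ℝ (Matrix n n ℂ)) (hPall : ∀ X : Matrix n n ℂ, X.IsHermitian → X ∈ P)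
    (hUu : ∀ i ν b, U i ν b ∈ Matrix.unitaryGroup n ℂ) {p : ℝ} (hp0 : 0 ≤ p) (i : ℕ)
    (hp : ∀ (x : Tor (fine (L * lev L i) M)) (ν μ : Fin d),
      ‖U (i + 1) ν (x, μ) * U (i + 1) μ (x + unitVec (fine (L * lev L i) M) ν, μ) - U (i + 1) μ (x, μ) * U (i + 1) ν (x + unitVec (fine (L * lev L i) M) μ, μ)‖ ≤ p)
    (hsmall : d * (L : ℝ) ^ 2 * p ≤ 1 / 4) (x : Tor (fine (lev L i) M)) (μ : Fin d) (r : Fin d → Fin L) : YxT L M U i x μ r ∈ P :=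
  hPall _ (Yx_letters L M hUu hp0 i hp hsmall x μ r).2

omit hM in
/-- transports of `G`-valued data are `G`-valued, for any multiplicatively closed `G ∋ 1`. [folklore] -/
theorem transport_mem_carrier (G : LogChart (Matrix n n ℂ)) {N : ℕ} {V : Fin d → (Tor (fine N M) × Fin d → Matrix n n ℂ)} (hV : ∀ ν b, V ν b ∈ G.carrier) (μ : Fin d) :
    ∀ P : List (Tor (fine N M) × Fin d), transport (fine N M) V μ P ∈ G.carrier
  | [] => by rw [transport, List.map_nil, List.prod_nil]; exact G.one_mem
  | b :: P => by
    rw [transport, List.map_cons, List.prod_cons]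
    exact G.mul_mem (hV _ _) (transport_mem_carrier G hV μ P)

omit hM in
/-- **STRUCTURE GROUPS WITH A LOGARITHMIC CHART** (`U(N)`, `SU(N)`, … — `BlockAveragingFederbushGValued.unitaryLogChart` / `specialUnitaryLogChart`): if the data are `G`-valued, `G` is
`⋆`-closed, its Lie algebra maps into the frame's carrier `P` under `X ↦ (−i)·X` (skew-adjoint ↦ hermitian), and the loop is within the chart radius (`d·L²·p ≤ ρ`), then the loop
logarithms lie in `P` (e.g. `P = 𝔰𝔲(N)`-hermitian for `SU(N)` data: `tr Y_x = 0` comes with the chart). [folklore] -/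
theorem YxT_mem_of_logChart [Nonempty n] (G : LogChart (Matrix n n ℂ)) (hGu : ∀ ⦃g⦄, g ∈ G.carrier → g ∈ Matrix.unitaryGroup n ℂ)
    (hGstar : ∀ ⦃g⦄, g ∈ G.carrier → star g ∈ G.carrier) (P : Submodule ℝ (Matrix n n ℂ)) (hPG : ∀ X ∈ G.lie, (-Complex.I) • X ∈ P)
    (hUG : ∀ i ν b, U i ν b ∈ G.carrier) {p : ℝ} (hp0 : 0 ≤ p) (i : ℕ)
    (hp : ∀ (x : Tor (fine (L * lev L i) M)) (ν μ : Fin d),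
      ‖U (i + 1) ν (x, μ) * U (i + 1) μ (x + unitVec (fine (L * lev L i) M) ν, μ) - U (i + 1) μ (x, μ) * U (i + 1) ν (x + unitVec (fine (L * lev L i) M) μ, μ)‖ ≤ p)
    (hsmall : d * (L : ℝ) ^ 2 * p ≤ G.ρ) (x : Tor (fine (lev L i) M)) (μ : Fin d) (r : Fin d → Fin L) : YxT L M U i x μ r ∈ P := by
  have hloopG : loopHol (L * lev L i) M (U (i + 1)) μ L (cpt (lev L i) L M x) (fun ν => (r ν : ℕ)) ∈ G.carrier := by
    rw [loopHol, ← Matrix.star_eq_conjTranspose]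
    exact G.mul_mem (transport_mem_carrier M G (hUG (i + 1)) μ _) (hGstar (G.mul_mem (transport_mem_carrier M G (hUG (i + 1)) μ _) (transport_mem_carrier M G (hUG (i + 1)) μ _)))
  have hl := norm_loopHol_sub_one_le_of_digits (L * lev L i) M μ L (V := U (i + 1)) (fun ν b => hGu (hUG (i + 1) ν b)) hp0 (fun y ν => hp y ν μ) (cpt (lev L i) L M x) r
  exact hPG _ (G.mlog_mem hloopG (hl.trans hsmall))

variable [Nonempty ι] {c : ℝ} (hc : 0 < c) (P : Submodule ℝ (Matrix n n ℂ)) (hPh : ∀ X ∈ P, X.IsHermitian) (e : ι → Matrix n n ℂ) (he : ∀ k, e k ∈ P)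
  (horth : ∀ k l, form c (e k) (e l) = if k = l then (1 : ℝ) else 0) (hcompl : ∀ X ∈ P, ∑ k, form c (e k) X • e k = X)
  (hPad : ∀ Y ∈ P, ∀ X ∈ P, Complex.I • (Y * X - X * Y) ∈ P)

include hc hPh he horth hcompl hPad in
omit hM in
/-- **THE (126) LETTER OF `G₁` FROM THE PLAQUETTE LETTER**: unitary `U`, plaquette letter `p` on the level-`(i+1)` field, `d·L²·p ≤ 1/16`, and the `Y_x` in the frame's carrier `P`
give `‖G₁ i x μ r‖ ≤ 64·d·L²·p` — print's «the operators occurring in these terms can be estimated by `O(L²α₀)`». [cite: Balaban1985Averaging, p.36] [folklore] -/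
theorem norm_remCoeffOf_G₁_le [Nonempty n] (hUu : ∀ i ν b, U i ν b ∈ Matrix.unitaryGroup n ℂ) {p : ℝ} (hp0 : 0 ≤ p) (i : ℕ)
    (hp : ∀ (x : Tor (fine (L * lev L i) M)) (ν μ : Fin d),
      ‖U (i + 1) ν (x, μ) * U (i + 1) μ (x + unitVec (fine (L * lev L i) M) ν, μ) - U (i + 1) μ (x, μ) * U (i + 1) ν (x + unitVec (fine (L * lev L i) M) μ, μ)‖ ≤ p)
    (hsmall : d * (L : ℝ) ^ 2 * p ≤ 1 / 16) (hYP : ∀ x μ r, YxT L M U i x μ r ∈ P) (W : (i : ℕ) → Fin d → (idx L M i → Matrix ι ι ℂ))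
    (x : Tor (fine (lev L i) M)) (μ : Fin d) (r : Fin d → Fin L) :
    ‖(remCoeffOf L M U c e W).G₁ i x μ r‖ ≤ 64 * (d * (L : ℝ) ^ 2 * p) := by
  have hs4 : d * (L : ℝ) ^ 2 * p ≤ 1 / 4 := hsmall.trans (by norm_num)
  have hl := Yx_letters L M hUu hp0 i hp hs4 x μ r
  have hb := Ybar_letters L M hUu hp0 i hp hs4 x μ
  have hYb : YbarT L M U i x μ ∈ P := P.sum_mem fun r' _ => P.smul_mem _ (hYP x μ r')
  have h := norm_coeffG₁_le hc P hPh e he horth hcompl hPad hYb (hYP x μ r) (y := 2 * (d * (L : ℝ) ^ 2 * p)) (by positivity) (by linarith) hb.1 hl.1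
  show ‖coeffG₁ c e (YbarT L M U i x μ) (YxT L M U i x μ r)‖ ≤ _
  linarith

include hc hPh he horth hcompl hPad in
omit hM in
/-- the (126) letter of `G₂`: `‖G₂ i x μ r‖ ≤ 64·d·L²·p`. [cite: Balaban1985Averaging, p.36] [folklore] -/
theorem norm_remCoeffOf_G₂_le [Nonempty n] (hUu : ∀ i ν b, U i ν b ∈ Matrix.unitaryGroup n ℂ) {p : ℝ} (hp0 : 0 ≤ p) (i : ℕ)
    (hp : ∀ (x : Tor (fine (L * lev L i) M)) (ν μ : Fin d),
      ‖U (i + 1) ν (x, μ) * U (i + 1) μ (x + unitVec (fine (L * lev L i) M) ν, μ) - U (i + 1) μ (x, μ) * U (i + 1) ν (x + unitVec (fine (L * lev L i) M) μ, μ)‖ ≤ p)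
    (hsmall : d * (L : ℝ) ^ 2 * p ≤ 1 / 16) (hYP : ∀ x μ r, YxT L M U i x μ r ∈ P) (W : (i : ℕ) → Fin d → (idx L M i → Matrix ι ι ℂ))
    (x : Tor (fine (lev L i) M)) (μ : Fin d) (r : Fin d → Fin L) :
    ‖(remCoeffOf L M U c e W).G₂ i x μ r‖ ≤ 64 * (d * (L : ℝ) ^ 2 * p) := by
  have hs4 : d * (L : ℝ) ^ 2 * p ≤ 1 / 4 := hsmall.trans (by norm_num)
  have hl := Yx_letters L M hUu hp0 i hp hs4 x μ r
  have hb := Ybar_letters L M hUu hp0 i hp hs4 x μ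
  have hYb : YbarT L M U i x μ ∈ P := P.sum_mem fun r' _ => P.smul_mem _ (hYP x μ r')
  have h := norm_coeffG₂_le hc P hPh e he horth hcompl hPad hYb (hYP x μ r) (y := 2 * (d * (L : ℝ) ^ 2 * p)) (by positivity) (by linarith) hb.1 hl.1
  show ‖coeffG₂ c e (YbarT L M U i x μ) (YxT L M U i x μ r)‖ ≤ _
  linarith

include hc hPh he horth hcompl hPad in
omit hM in
/-- the (126) letter of `G₃` (block weight `L^{−d}`, a probability weight): `‖G₃ i x μ‖ ≤ 64·d·L²·p`. [cite: Balaban1985Averaging, p.36] [folklore] -/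
theorem norm_remCoeffOf_G₃_le [Nonempty n] (hUu : ∀ i ν b, U i ν b ∈ Matrix.unitaryGroup n ℂ) {p : ℝ} (hp0 : 0 ≤ p) (i : ℕ)
    (hp : ∀ (x : Tor (fine (L * lev L i) M)) (ν μ : Fin d),
      ‖U (i + 1) ν (x, μ) * U (i + 1) μ (x + unitVec (fine (L * lev L i) M) ν, μ) - U (i + 1) μ (x, μ) * U (i + 1) ν (x + unitVec (fine (L * lev L i) M) μ, μ)‖ ≤ p)
    (hsmall : d * (L : ℝ) ^ 2 * p ≤ 1 / 16) (hYP : ∀ x μ r, YxT L M U i x μ r ∈ P) (W : (i : ℕ) → Fin d → (idx L M i → Matrix ι ι ℂ))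
    (x : Tor (fine (lev L i) M)) (μ : Fin d) :
    ‖(remCoeffOf L M U c e W).G₃ i x μ‖ ≤ 64 * (d * (L : ℝ) ^ 2 * p) := by
  have hs4 : d * (L : ℝ) ^ 2 * p ≤ 1 / 4 := hsmall.trans (by norm_num)
  have hl := fun r => Yx_letters L M hUu hp0 i hp hs4 x μ r
  have hb := Ybar_letters L M hUu hp0 i hp hs4 x μ
  have hYb : YbarT L M U i x μ ∈ P := P.sum_mem fun r' _ => P.smul_mem _ (hYP x μ r')
  have h := norm_coeffG₃_le hc P hPh e he horth hcompl hPad Finset.univ (w := fun _ : Fin d → Fin L => ((L : ℝ) ^ d)⁻¹) (fun _ _ => by positivity)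
    (sum_blockWeight L) hYb (Yx := fun r => YxT L M U i x μ r) (fun r _ => hYP x μ r) (y := 2 * (d * (L : ℝ) ^ 2 * p)) (by positivity) (by linarith) hb.1
    (fun r _ => (hl r).1)
  show ‖coeffG₃ Finset.univ (fun _ : Fin d → Fin L => ((L : ℝ) ^ d)⁻¹) c e (YbarT L M U i x μ) (fun r => YxT L M U i x μ r)‖ ≤ _
  linarith

omit hM [Nonempty ι] in
/-- the coarse-bond transporter is contractive when the adjoint tower is. [folklore] -/
theorem norm_remCoeffOf_Rc_le {W : (i : ℕ) → Fin d → (idx L M i → Matrix ι ι ℂ)} (hWn : ∀ i ν b, ‖W i ν b‖ ≤ 1) (i : ℕ)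
    (x : Tor (fine (lev L i) M)) (μ : Fin d) : ‖(remCoeffOf L M U c e W).Rc i x μ‖ ≤ 1 :=
  hWn i μ (x, μ)

end Letters

end Summit.QuantumFields.BalabanUV.T4Continuum.NE2.OneStepRemainderLoopCoeff

end
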